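import Summits.AtomisticToContinuum.BoseEinsteinCondensation.Theorems.DensityResponse.Negative.LoadBearingDilute
import Literature.MathematicalPhysics.QuantumManyBody.LangevinGenerator
import Literature.MathematicalPhysics.QuantumManyBody.PeriodicBoseGasImpurity

/-!
# Negative lemmas for crux `DensityResponse` (stmt-AtomisticToContinuum-9481), V: the free chord

Supports (does not close) stmt-AtomisticToContinuum-9481 (route `BECThomsonPrinciple`, rank 4); landed
copy of §9 of `Cruxes/DensityResponse/Disproof.lean` (generation 2, re-deriving generation 1's
finding (f) importably); `sorry`-free, standard axioms; no `Theses` decl asserted.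

* `free_chord`: for EVERY `N`, `L > 0`, `n ≠ 0`, `s ≥ 0` and periodic trial state `Φ`,
  `ofReal(s|⟨Σᵢ2cos k·xᵢ⟩_Φ|) ≤ ∫⁻|∇Φ|² + ofReal(4s²N/k∞²)`, `k∞ = 2π‖n‖∞/L` (torus IBP
  `integral_cellN_pderiv_eq_zero` against `sin θᵢ|Φ|²` along the sup-norm axis of `n`,
  `HasFDerivAt.norm_sq`, pointwise AM–GM with `ε = k∞/2s`); `free_chord_energy` (relative to `E_v(Φ)`,
  every `v`); `holds_free_four`: the free gas satisfies the conclusion of the crux with `C = 4` for any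
  `M, ρ₀, N₀`.  Hence the crux's content is exactly "subtract `E₀(v)` while keeping the `ρa` stiffness".
-/

noncomputable section

open MeasureTheory Set Filter Metric
open scoped ENNReal NNReal BigOperators Classical

namespace Summit.AtomisticToContinuum.BoseEinsteinCondensation.Theorems.DensityResponse.Negative

open Literature.MathematicalPhysics.QuantumManyBody.BoseGas

section FreeChord

variable {N : ℕ} {L : ℝ}

/-- The closed cube `[0,L]^{3N}` is compact. [folklore] -/
theorem isCompact_closedCube (N : ℕ) (L : ℝ) : IsCompact {X : Config N | ∀ i k, X i k ∈ Set.Icc 0 L} := by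
  have hC : IsCompact {x : Space | ∀ k, x k ∈ Set.Icc 0 L} := by
    have : {x : Space | ∀ k, x k ∈ Set.Icc 0 L} =
        (WithLp.toLp 2) '' (Set.univ.pi fun _ : Fin 3 => Set.Icc (0 : ℝ) L) := by
      ext x
      simp only [Set.mem_setOf_eq, Set.mem_image, Set.mem_univ_pi]
      constructor
      · intro h; exact ⟨WithLp.ofLp x, h, rfl⟩
      · rintro ⟨y, hy, rfl⟩; exact hy
    rw [this]
    exact (isCompact_univ_pi fun _ => isCompact_Icc).image (PiLp.continuous_toLp 2 _)
  have : {X : Config N | ∀ i k, X i k ∈ Set.Icc 0 L} =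
      Set.univ.pi fun _ : Fin N => {x : Space | ∀ k, x k ∈ Set.Icc 0 L} := by
    ext X; simp only [Set.mem_setOf_eq, Set.mem_univ_pi]
  rw [this]
  exact isCompact_univ_pi fun _ => hC

/-- **Continuous functions are integrable on the cell `[0,L)^{3N}`** (bounded on the compact closed
cube, finite volume). [folklore] -/
theorem integrableOn_cellN_of_continuous {E : Type*} [NormedAddCommGroup E] {f : Config N → E}
    (hf : Continuous f) (L : ℝ) : IntegrableOn f (cellN N L) := by
  obtain ⟨M, hM⟩ := (isCompact_closedCube N L).exists_bound_of_continuousOn hf.continuousOn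
  refine Measure.integrableOn_of_bounded (M := M) ?_ hf.aestronglyMeasurable ?_
  · rw [volume_cellN]; exact ENNReal.pow_ne_top (ENNReal.pow_ne_top ENNReal.ofReal_ne_top)
  · refine ae_restrict_of_forall_mem (measurableSet_cellN N L) fun X hX => hM X fun i k => ?_
    exact Set.Ico_subset_Icc_self (hX i k)

/-- The phase of particle `i`: `θᵢ(X) = (2π/L) ∑ⱼ nⱼ x_{i,j}`. [folklore] -/
def phase (n : Fin 3 → ℤ) (L : ℝ) (i : Fin N) (X : Config N) : ℝ :=
  2 * Real.pi / L * ∑ j, (n j : ℝ) * X i j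

/-- `EuclideanSpace.proj j x = x j`. [folklore] -/
@[simp] theorem euclideanProj_apply (j : Fin 3) (x : Space) : EuclideanSpace.proj (𝕜 := ℝ) j x = x j := rfl

/-- The phase as a continuous linear form. [folklore] -/
def phaseCLM (n : Fin 3 → ℤ) (L : ℝ) (i : Fin N) : Config N →L[ℝ] ℝ :=
  (2 * Real.pi / L) • ∑ j : Fin 3, (n j : ℝ) •
    ((EuclideanSpace.proj (𝕜 := ℝ) j).comp (ContinuousLinearMap.proj (R := ℝ) (φ := fun _ => Space) i))

/-- The linear form agrees with the phase. [folklore] -/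
theorem phaseCLM_apply (n : Fin 3 → ℤ) (L : ℝ) (i : Fin N) (X : Config N) :
    phaseCLM n L i X = phase n L i X := by
  simp only [phaseCLM, phase, smul_apply, FunLike.coe_sum, Finset.sum_apply,
    ContinuousLinearMap.comp_apply, ContinuousLinearMap.proj_apply, euclideanProj_apply, smul_eq_mul]

/-- The phase is its own derivative. [folklore] -/
theorem hasFDerivAt_phase (n : Fin 3 → ℤ) (L : ℝ) (i : Fin N) (X : Config N) :
    HasFDerivAt (phase n L i) (phaseCLM n L i) X := by
  have : (phase n L i : Config N → ℝ) = phaseCLM n L i := by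
    funext Y; rw [phaseCLM_apply]
  rw [this]
  exact (phaseCLM n L i).hasFDerivAt

/-- The phase is smooth. [folklore] -/
theorem contDiff_phase (n : Fin 3 → ℤ) (L : ℝ) (i : Fin N) : ContDiff ℝ 1 (phase n L i : Config N → ℝ) := by
  have : (phase n L i : Config N → ℝ) = phaseCLM n L i := by
    funext Y; rw [phaseCLM_apply]
  rw [this]
  exact (phaseCLM n L i).contDiff

/-- The phase is continuous. [folklore] -/
theorem continuous_phase (n : Fin 3 → ℤ) (L : ℝ) (i : Fin N) : Continuous (phase n L i : Config N → ℝ) :=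
  (contDiff_phase n L i).continuous

/-- `∂_{i',l} θᵢ = (2π/L) n_l [i' = i]`. [folklore] -/
theorem phaseCLM_unitVec (n : Fin 3 → ℤ) (L : ℝ) (i i' : Fin N) (l : Fin 3) :
    phaseCLM n L i (unitVec i' l) = if i' = i then 2 * Real.pi / L * n l else 0 := by
  rw [phaseCLM_apply, phase]
  by_cases h : i' = i
  · subst h
    rw [if_pos rfl]
    congr 1
    simp [unitVec, PiLp.single_apply]
  · rw [if_neg h]
    simp [unitVec, Pi.single_eq_of_ne (Ne.symm h)]

/-- Lattice shifts change the phase by an integer multiple of `2π`. [folklore] -/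
theorem phase_add_single (hL : L ≠ 0) (n : Fin 3 → ℤ) (i i' : Fin N) (k : Fin 3) (X : Config N) :
    phase n L i (X + Pi.single i' (EuclideanSpace.single k L)) =
      phase n L i X + (if i' = i then ((n k : ℤ) : ℝ) * (2 * Real.pi) else 0) := by
  unfold phase
  by_cases h : i' = i
  · subst h
    rw [if_pos rfl]
    simp only [Pi.add_apply, Pi.single_eq_same, PiLp.add_apply, PiLp.single_apply, mul_add,
      Finset.sum_add_distrib, mul_ite, mul_zero, Finset.sum_ite_eq', Finset.mem_univ, if_true]
    field_simp
  · rw [if_neg h]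
    simp [Pi.single_eq_of_ne (Ne.symm h)]

/-- `sin θᵢ` is lattice periodic. [folklore] -/
theorem sin_phase_periodic (hL : L ≠ 0) (n : Fin 3 → ℤ) (i : Fin N) :
    IsLatticePeriodic L (fun X : Config N => Real.sin (phase n L i X)) := by
  intro X i' k
  simp only
  rw [phase_add_single hL]
  split_ifs
  · exact Real.sin_add_int_mul_two_pi _ _
  · rw [add_zero]

/-- `|Φ|²` is lattice periodic. [folklore] -/
theorem normSq_periodic (Φ : PeriodicTrialState N L) :
    IsLatticePeriodic L (fun X : Config N => ‖Φ.ψ X‖ ^ 2) := by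
  intro X i k
  simp only [Φ.periodic X i k]

/-- **Integration by parts on the torus against `sin θᵢ |Φ|²`**:
`(2πn_l/L) ∫ cos θᵢ |Φ|² = -∫ sin θᵢ · 2⟪Φ, ∂_{i,l}Φ⟫`. [folklore] -/
theorem ibp_cos_normSq (hL : 0 < L) (n : Fin 3 → ℤ) (Φ : PeriodicTrialState N L) (i : Fin N) (l : Fin 3) :
    (2 * Real.pi / L * n l) * ∫ X in cellN N L, Real.cos (phase n L i X) * ‖Φ.ψ X‖ ^ 2 =
      - ∫ X in cellN N L, Real.sin (phase n L i X) *
          (2 * @inner ℝ ℂ _ (Φ.ψ X) (fderiv ℝ Φ.ψ X (unitVec i l))) := by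
  set G : Config N → ℝ := fun X => Real.sin (phase n L i X) * ‖Φ.ψ X‖ ^ 2 with hG_def
  have hΦd : Differentiable ℝ Φ.ψ := Φ.contDiff.differentiable one_ne_zero
  have hGc : ContDiff ℝ 1 G :=
    (Real.contDiff_sin.comp (contDiff_phase n L i)).mul (Φ.contDiff.norm_sq ℝ)
  have hGp : IsLatticePeriodic L G := (sin_phase_periodic hL.ne' n i).mul (normSq_periodic Φ)
  have hder : ∀ X, pderiv i l G X = (2 * Real.pi / L * n l) * (Real.cos (phase n L i X) * ‖Φ.ψ X‖ ^ 2) +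
      Real.sin (phase n L i X) * (2 * @inner ℝ ℂ _ (Φ.ψ X) (fderiv ℝ Φ.ψ X (unitVec i l))) := by
    intro X
    have hs : HasFDerivAt (fun Y => Real.sin (phase n L i Y))
        (Real.cos (phase n L i X) • phaseCLM n L i) X := (hasFDerivAt_phase n L i X).sin
    have hq : HasFDerivAt (fun Y => ‖Φ.ψ Y‖ ^ 2)
        (2 • (innerSL ℝ (Φ.ψ X)).comp (fderiv ℝ Φ.ψ X)) X := (hΦd X).hasFDerivAt.norm_sq
    have hm := (hs.mul hq).fderiv
    have hGeq : G = ((fun Y => Real.sin (phase n L i Y)) * fun Y => ‖Φ.ψ Y‖ ^ 2) := rfl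
    change fderiv ℝ G X (unitVec i l) = _
    rw [hGeq, hm]
    simp only [FunLike.coe_add, Pi.add_apply, smul_apply, ContinuousLinearMap.comp_apply,
      phaseCLM_unitVec, smul_eq_mul]
    change Real.sin (phase n L i X) * ((2 : ℕ) • @inner ℝ ℂ _ (Φ.ψ X) (fderiv ℝ Φ.ψ X (unitVec i l))) +
      ‖Φ.ψ X‖ ^ 2 * (Real.cos (phase n L i X) * (2 * Real.pi / L * ↑(n l))) = _
    rw [nsmul_eq_mul]
    push_cast
    ring
  have hibp := integral_cellN_pderiv_eq_zero hL hGc hGp i l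
  simp_rw [hder] at hibp
  have hA : IntegrableOn (fun X => (2 * Real.pi / L * n l) * (Real.cos (phase n L i X) * ‖Φ.ψ X‖ ^ 2))
      (cellN N L) :=
    integrableOn_cellN_of_continuous (continuous_const.mul
      ((Real.continuous_cos.comp (continuous_phase n L i)).mul (Φ.contDiff.continuous.norm.pow 2))) L
  have hB : IntegrableOn (fun X => Real.sin (phase n L i X) *
      (2 * @inner ℝ ℂ _ (Φ.ψ X) (fderiv ℝ Φ.ψ X (unitVec i l)))) (cellN N L) :=
    integrableOn_cellN_of_continuous ((Real.continuous_sin.comp (continuous_phase n L i)).mul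
      (continuous_const.mul (Φ.contDiff.continuous.inner
        ((Φ.contDiff.continuous_fderiv one_ne_zero).clm_apply continuous_const)))) L
  rw [integral_add hA hB, integral_const_mul] at hibp
  linarith

/-- **Per-particle bound**: `|∫ 2cos θᵢ |Φ|²| ≤ (2/k∞)(ε ∫|∂_{i,l}Φ|² + ε⁻¹)` for the sup-norm axis `l`
and every `ε > 0` (IBP + pointwise AM–GM + normalisation). [folklore] -/
theorem abs_integral_two_cos_le (hL : 0 < L) (n : Fin 3 → ℤ) (Φ : PeriodicTrialState N L) (i : Fin N)
    {l : Fin 3} (hl : n l ≠ 0) {ε : ℝ} (hε : 0 < ε) :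
    |∫ X in cellN N L, 2 * Real.cos (phase n L i X) * ‖Φ.ψ X‖ ^ 2| ≤
      2 / (2 * Real.pi / L * |(n l : ℝ)|) *
        (ε * (∫ X in cellN N L, ‖fderiv ℝ Φ.ψ X (unitVec i l)‖ ^ 2) + ε⁻¹) := by
  have hk : 0 < 2 * Real.pi / L * |(n l : ℝ)| := by
    have : (0 : ℝ) < |(n l : ℝ)| := abs_pos.2 (by exact_mod_cast hl)
    positivity
  have hibp := ibp_cos_normSq hL n Φ i l
  have hD : Continuous fun X => fderiv ℝ Φ.ψ X (unitVec i l) :=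
    (Φ.contDiff.continuous_fderiv one_ne_zero).clm_apply continuous_const
  have hint1 : IntegrableOn (fun X => ‖fderiv ℝ Φ.ψ X (unitVec i l)‖ ^ 2) (cellN N L) :=
    integrableOn_cellN_of_continuous (hD.norm.pow 2) L
  have hint2 : IntegrableOn (fun X => ‖Φ.ψ X‖ ^ 2) (cellN N L) := integrableOn_cellN_norm_sq Φ
  have hbound : |∫ X in cellN N L, Real.sin (phase n L i X) *
      (2 * @inner ℝ ℂ _ (Φ.ψ X) (fderiv ℝ Φ.ψ X (unitVec i l)))| ≤
      ε * (∫ X in cellN N L, ‖fderiv ℝ Φ.ψ X (unitVec i l)‖ ^ 2) + ε⁻¹ := by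
    have hpt : ∀ X : Config N, |Real.sin (phase n L i X) *
        (2 * @inner ℝ ℂ _ (Φ.ψ X) (fderiv ℝ Φ.ψ X (unitVec i l)))| ≤
        ε * ‖fderiv ℝ Φ.ψ X (unitVec i l)‖ ^ 2 + ε⁻¹ * ‖Φ.ψ X‖ ^ 2 := by
      intro X
      have h1 : |Real.sin (phase n L i X)| ≤ 1 := Real.abs_sin_le_one _
      have h2 := abs_real_inner_le_norm (Φ.ψ X) (fderiv ℝ Φ.ψ X (unitVec i l))
      have h3 : |Real.sin (phase n L i X) * (2 * @inner ℝ ℂ _ (Φ.ψ X) (fderiv ℝ Φ.ψ X (unitVec i l)))| ≤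
          2 * (‖Φ.ψ X‖ * ‖fderiv ℝ Φ.ψ X (unitVec i l)‖) := by
        rw [abs_mul, abs_mul, abs_two]
        calc |Real.sin (phase n L i X)| * (2 * |@inner ℝ ℂ _ (Φ.ψ X) (fderiv ℝ Φ.ψ X (unitVec i l))|)
            ≤ 1 * (2 * (‖Φ.ψ X‖ * ‖fderiv ℝ Φ.ψ X (unitVec i l)‖)) := by gcongr
          _ = _ := one_mul _
      have h4 : 2 * (‖Φ.ψ X‖ * ‖fderiv ℝ Φ.ψ X (unitVec i l)‖) ≤
          ε * ‖fderiv ℝ Φ.ψ X (unitVec i l)‖ ^ 2 + ε⁻¹ * ‖Φ.ψ X‖ ^ 2 := by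
        have hsq := sq_nonneg (ε * ‖fderiv ℝ Φ.ψ X (unitVec i l)‖ - ‖Φ.ψ X‖)
        have hid : ε * ‖fderiv ℝ Φ.ψ X (unitVec i l)‖ ^ 2 + ε⁻¹ * ‖Φ.ψ X‖ ^ 2 -
            2 * (‖Φ.ψ X‖ * ‖fderiv ℝ Φ.ψ X (unitVec i l)‖) =
            (ε * ‖fderiv ℝ Φ.ψ X (unitVec i l)‖ - ‖Φ.ψ X‖) ^ 2 / ε := by
          field_simp
          ring
        have : 0 ≤ (ε * ‖fderiv ℝ Φ.ψ X (unitVec i l)‖ - ‖Φ.ψ X‖) ^ 2 / ε := div_nonneg hsq hε.le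
        linarith
      exact h3.trans h4
    calc |∫ X in cellN N L, Real.sin (phase n L i X) *
          (2 * @inner ℝ ℂ _ (Φ.ψ X) (fderiv ℝ Φ.ψ X (unitVec i l)))|
        ≤ ∫ X in cellN N L, |Real.sin (phase n L i X) *
          (2 * @inner ℝ ℂ _ (Φ.ψ X) (fderiv ℝ Φ.ψ X (unitVec i l)))| := abs_integral_le_integral_abs
      _ ≤ ∫ X in cellN N L, (ε * ‖fderiv ℝ Φ.ψ X (unitVec i l)‖ ^ 2 + ε⁻¹ * ‖Φ.ψ X‖ ^ 2) :=
          integral_mono_of_nonneg (ae_of_all _ fun X => abs_nonneg _)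
            ((hint1.const_mul ε).fun_add (hint2.const_mul ε⁻¹)) (ae_of_all _ hpt)
      _ = ε * (∫ X in cellN N L, ‖fderiv ℝ Φ.ψ X (unitVec i l)‖ ^ 2) + ε⁻¹ := by
          rw [integral_add (hint1.const_mul ε) (hint2.const_mul ε⁻¹), integral_const_mul,
            integral_const_mul, integral_cellN_norm_sq, mul_one]
  have hcos : ∫ X in cellN N L, 2 * Real.cos (phase n L i X) * ‖Φ.ψ X‖ ^ 2 =
      2 * ∫ X in cellN N L, Real.cos (phase n L i X) * ‖Φ.ψ X‖ ^ 2 := by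
    rw [← integral_const_mul]
    refine integral_congr_ae (ae_of_all _ fun X => by ring)
  rw [hcos, abs_mul, abs_two]
  have hkey : |2 * Real.pi / L * (n l : ℝ)| * |∫ X in cellN N L, Real.cos (phase n L i X) * ‖Φ.ψ X‖ ^ 2| ≤
      ε * (∫ X in cellN N L, ‖fderiv ℝ Φ.ψ X (unitVec i l)‖ ^ 2) + ε⁻¹ := by
    rw [← abs_mul, hibp, abs_neg]
    exact hbound
  rw [abs_mul, abs_of_pos (by positivity : (0 : ℝ) < 2 * Real.pi / L)] at hkey
  rw [div_mul_eq_mul_div, le_div_iff₀ hk]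
  nlinarith [hkey, abs_nonneg (∫ X in cellN N L, Real.cos (phase n L i X) * ‖Φ.ψ X‖ ^ 2)]

/-- The directional kinetic energy is below the kinetic `lintegral`:
`ofReal (∑ᵢ ∫ |∂_{i,l}Φ|²) ≤ ∫⁻ kineticDensity Φ`. [folklore] -/
theorem ofReal_sum_integral_pderiv_sq_le (Φ : PeriodicTrialState N L) (l : Fin 3) :
    ENNReal.ofReal (∑ i, ∫ X in cellN N L, ‖fderiv ℝ Φ.ψ X (unitVec i l)‖ ^ 2) ≤
      ∫⁻ X in cellN N L, kineticDensity Φ.ψ X := by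
  have hD : ∀ i, Continuous fun X => fderiv ℝ Φ.ψ X (unitVec i l) := fun i =>
    (Φ.contDiff.continuous_fderiv one_ne_zero).clm_apply continuous_const
  have hint : ∀ i, IntegrableOn (fun X => ‖fderiv ℝ Φ.ψ X (unitVec i l)‖ ^ 2) (cellN N L) := fun i =>
    integrableOn_cellN_of_continuous ((hD i).norm.pow 2) L
  rw [ENNReal.ofReal_sum_of_nonneg fun i _ => integral_nonneg fun X => sq_nonneg _]
  have h1 : ∀ i, ENNReal.ofReal (∫ X in cellN N L, ‖fderiv ℝ Φ.ψ X (unitVec i l)‖ ^ 2) =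
      ∫⁻ X in cellN N L, (‖fderiv ℝ Φ.ψ X (unitVec i l)‖₊ : ℝ≥0∞) ^ 2 := by
    intro i
    rw [ofReal_integral_eq_lintegral_ofReal (hint i) (ae_of_all _ fun X => sq_nonneg _)]
    refine lintegral_congr fun X => ?_
    rw [← ennnorm_sq_eq]
  simp_rw [h1]
  rw [← lintegral_finsetSum _ fun i _ => ?_]
  · refine lintegral_mono fun X => ?_
    unfold kineticDensity
    refine Finset.sum_le_sum fun i _ => ?_
    exact Finset.single_le_sum (f := fun k => (‖fderiv ℝ Φ.ψ X (unitVec i k)‖₊ : ℝ≥0∞) ^ 2)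
      (fun _ _ => bot_le) (Finset.mem_univ l)
  · exact ((measurable_fderiv_apply_const ℝ Φ.ψ _).nnnorm.coe_nnreal_ennreal).pow_const 2

/-- **THE FREE CHORD** (`C = 4`): `ofReal (s |⟨Σᵢ 2cos(k·xᵢ)⟩_Φ|) ≤ ∫⁻ |∇Φ|² + ofReal (4 s² N / k∞²)`
for every `N`, `L > 0`, `n ≠ 0`, `s ≥ 0`, `Φ` (IBP along the sup-norm axis, AM–GM `ε = k∞/2s`). [folklore] -/
theorem free_chord (hL : 0 < L) {n : Fin 3 → ℤ} (hn : n ≠ 0) {s : ℝ} (hs : 0 ≤ s)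
    (Φ : PeriodicTrialState N L) :
    ENNReal.ofReal (s * |∫ X in cellN N L,
        (∑ i, 2 * Real.cos (2 * Real.pi / L * ∑ j, (n j : ℝ) * X i j)) * ‖Φ.ψ X‖ ^ 2|) ≤
      (∫⁻ X in cellN N L, kineticDensity Φ.ψ X) +
        ENNReal.ofReal (4 * s ^ 2 * N / (2 * Real.pi * ‖(fun j => (n j : ℝ))‖ / L) ^ 2) := by
  obtain ⟨l, -, hl⟩ := Finset.exists_mem_eq_sup (Finset.univ : Finset (Fin 3)) Finset.univ_nonempty
    (fun b => ‖(fun j => (n j : ℝ)) b‖₊)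
  have hnorm : ‖(fun j => (n j : ℝ))‖ = |(n l : ℝ)| := by
    rw [Pi.norm_def, hl, coe_nnnorm, Real.norm_eq_abs]
  have hnl : n l ≠ 0 := by
    intro h0
    have : ‖(fun j => (n j : ℝ))‖ = 0 := by rw [hnorm, h0]; simp
    rw [norm_eq_zero] at this
    exact hn (funext fun j => by have h' : (n j : ℝ) = 0 := congr_fun this j; exact_mod_cast h')
  set k : ℝ := 2 * Real.pi / L * |(n l : ℝ)| with hk_def
  have hk : 0 < k := by
    have : (0 : ℝ) < |(n l : ℝ)| := abs_pos.2 (by exact_mod_cast hnl)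
    positivity
  have hkeq : 2 * Real.pi * ‖(fun j => (n j : ℝ))‖ / L = k := by rw [hnorm, hk_def]; ring
  rw [hkeq]
  set T : ℝ := ∑ i, ∫ X in cellN N L, ‖fderiv ℝ Φ.ψ X (unitVec i l)‖ ^ 2 with hT_def
  have hT0 : 0 ≤ T := Finset.sum_nonneg fun i _ => integral_nonneg fun X => sq_nonneg _
  have hsrc : ∫ X in cellN N L, (∑ i, 2 * Real.cos (2 * Real.pi / L * ∑ j, (n j : ℝ) * X i j)) * ‖Φ.ψ X‖ ^ 2 =
      ∑ i, ∫ X in cellN N L, 2 * Real.cos (phase n L i X) * ‖Φ.ψ X‖ ^ 2 := by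
    simp_rw [Finset.sum_mul]
    rw [integral_finsetSum _ fun i _ => ?_]
    · rfl
    · exact integrableOn_cellN_of_continuous ((continuous_const.mul
        (Real.continuous_cos.comp (continuous_phase n L i))).mul (Φ.contDiff.continuous.norm.pow 2)) L
  have hsum : ∀ {ε : ℝ}, 0 < ε → |∫ X in cellN N L,
      (∑ i, 2 * Real.cos (2 * Real.pi / L * ∑ j, (n j : ℝ) * X i j)) * ‖Φ.ψ X‖ ^ 2| ≤
      2 / k * (ε * T + N * ε⁻¹) := by
    intro ε hε
    rw [hsrc]
    calc |∑ i, ∫ X in cellN N L, 2 * Real.cos (phase n L i X) * ‖Φ.ψ X‖ ^ 2|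
        ≤ ∑ i, |∫ X in cellN N L, 2 * Real.cos (phase n L i X) * ‖Φ.ψ X‖ ^ 2| := Finset.abs_sum_le_sum_abs _ _
      _ ≤ ∑ i, 2 / k * (ε * (∫ X in cellN N L, ‖fderiv ℝ Φ.ψ X (unitVec i l)‖ ^ 2) + ε⁻¹) :=
          Finset.sum_le_sum fun i _ => abs_integral_two_cos_le hL n Φ i hnl hε
      _ = 2 / k * (ε * T + N * ε⁻¹) := by
          rw [← Finset.mul_sum, Finset.sum_add_distrib, ← Finset.mul_sum, Finset.sum_const,
            Finset.card_univ, Fintype.card_fin, nsmul_eq_mul]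
  have hreal : s * |∫ X in cellN N L,
      (∑ i, 2 * Real.cos (2 * Real.pi / L * ∑ j, (n j : ℝ) * X i j)) * ‖Φ.ψ X‖ ^ 2| ≤
      T + 4 * s ^ 2 * N / k ^ 2 := by
    rcases hs.eq_or_lt with rfl | hs'
    · rw [zero_mul]; positivity
    · have h := mul_le_mul_of_nonneg_left (hsum (show 0 < k / (2 * s) by positivity)) hs
      refine h.trans (le_of_eq ?_)
      field_simp
      ring
  calc ENNReal.ofReal (s * |∫ X in cellN N L,
        (∑ i, 2 * Real.cos (2 * Real.pi / L * ∑ j, (n j : ℝ) * X i j)) * ‖Φ.ψ X‖ ^ 2|)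
      ≤ ENNReal.ofReal (T + 4 * s ^ 2 * N / k ^ 2) := ENNReal.ofReal_le_ofReal hreal
    _ = ENNReal.ofReal T + ENNReal.ofReal (4 * s ^ 2 * N / k ^ 2) := ENNReal.ofReal_add hT0 (by positivity)
    _ ≤ (∫⁻ X in cellN N L, kineticDensity Φ.ψ X) + ENNReal.ofReal (4 * s ^ 2 * N / k ^ 2) := by
        gcongr
        exact ofReal_sum_integral_pderiv_sq_le Φ l

/-- **Free chord relative to the total energy** (`free_type_bound_all_v` of generation 1): for every
`v`, `ofReal (s|⟨V_k⟩|) ≤ E_v(Φ) + ofReal (4s²N/k∞²)`. [folklore] -/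
theorem free_chord_energy (hL : 0 < L) (v : ℝ → ℝ≥0∞) {n : Fin 3 → ℤ} (hn : n ≠ 0) {s : ℝ} (hs : 0 ≤ s)
    (Φ : PeriodicTrialState N L) :
    ENNReal.ofReal (s * |∫ X in cellN N L,
        (∑ i, 2 * Real.cos (2 * Real.pi / L * ∑ j, (n j : ℝ) * X i j)) * ‖Φ.ψ X‖ ^ 2|) ≤
      periodicEnergy v Φ + ENNReal.ofReal (4 * s ^ 2 * N / (2 * Real.pi * ‖(fun j => (n j : ℝ))‖ / L) ^ 2) :=
  (free_chord hL hn hs Φ).trans (add_le_add (lintegral_mono fun _ => le_self_add) le_rfl)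

/-- The free periodic energy is the kinetic energy. [folklore] -/
theorem periodicEnergy_zero_eq (Φ : PeriodicTrialState N L) :
    periodicEnergy 0 Φ = ∫⁻ X in cellN N L, kineticDensity Φ.ψ X := by
  refine lintegral_congr fun X => ?_
  have : periodicInteraction (N := N) 0 L X = 0 := by
    unfold periodicInteraction
    simp [periodizedPotential_zero]
  rw [this, zero_mul, add_zero]

/-- The constant state `L^{-3N/2}` on the torus (`N` particles). [folklore] -/
def constState (N : ℕ) (hL : 0 < L) : PeriodicTrialState N L where
  ψ _ := ((Real.sqrt ((L ^ 3) ^ N))⁻¹ : ℂ)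
  contDiff := contDiff_const
  periodic _ _ _ := rfl
  symm _ _ := rfl
  norm_eq := by
    have hV : 0 < (L ^ 3) ^ N := by positivity
    have hc : ((‖((Real.sqrt ((L ^ 3) ^ N))⁻¹ : ℂ)‖₊ : ℝ≥0∞) ^ 2) = ENNReal.ofReal (((L ^ 3) ^ N)⁻¹) := by
      rw [← ENNReal.coe_pow, ENNReal.ofReal, ENNReal.coe_inj]
      ext
      rw [NNReal.coe_pow, coe_nnnorm, norm_inv, Complex.norm_real,
        Real.norm_of_nonneg (Real.sqrt_nonneg _), inv_pow, Real.sq_sqrt hV.le,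
        Real.coe_toNNReal _ (by positivity)]
    rw [setLIntegral_const, volume_cellN, hc, ← ENNReal.ofReal_pow hL.le,
      ← ENNReal.ofReal_pow (by positivity), ← ENNReal.ofReal_mul (by positivity),
      inv_mul_cancel₀ hV.ne', ENNReal.ofReal_one]

/-- `E₀^per(v = 0) = 0`. [folklore] -/
theorem periodicGroundStateEnergy_zero (N : ℕ) (hL : 0 < L) : periodicGroundStateEnergy 0 N L = 0 := by
  refine le_antisymm ((periodicGroundStateEnergy_le 0 (constState N hL)).trans (le_of_eq ?_)) bot_le
  rw [periodicEnergy_zero_eq]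
  refine (lintegral_congr fun X => ?_).trans lintegral_zero
  simp [constState, kineticDensity]

/-- **THE FREE GAS SATISFIES THE CRUX WITH `C = 4`**: the conclusion of `DensityResponse` for `v = 0`
with ANY `M, ρ₀, N₀` (`a(0) = 0`; with gen 1's `C ≥ 2` the free optimal constant is in `[2,4]`). [folklore] -/
theorem holds_free_four (M ρ₀ : ℝ) (N₀ : ℕ) :
    ∀ N : ℕ, N₀ ≤ N → ∀ L : ℝ, 0 < L → (N : ℝ) ≤ ρ₀ * L ^ 3 → ∀ n : Fin 3 → ℤ, n ≠ 0 →
    2 * Real.pi * ‖(fun j => (n j : ℝ))‖ / L ≤ M * Real.sqrt (N / L ^ 3) → ∀ s : ℝ, 0 ≤ s →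
    ∀ Φ : PeriodicTrialState N L,
      periodicGroundStateEnergy 0 N L + ENNReal.ofReal (s * |∫ X in cellN N L,
        (∑ i, 2 * Real.cos (2 * Real.pi / L * ∑ j, (n j : ℝ) * X i j)) * ‖Φ.ψ X‖ ^ 2|) ≤
      periodicEnergy 0 Φ + ENNReal.ofReal (4 * s ^ 2 * N /
        ((2 * Real.pi * ‖(fun j => (n j : ℝ))‖ / L) ^ 2 + N / L ^ 3 * (scatteringLength 0).toReal)) := by
  intro N _ L hL _ n hn _ s hs Φ
  rw [periodicGroundStateEnergy_zero N hL, zero_add, scatteringLength_zero, ENNReal.toReal_zero,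
    mul_zero, add_zero]
  exact free_chord_energy hL 0 hn hs Φ

end FreeChord

end Summit.AtomisticToContinuum.BoseEinsteinCondensation.Theorems.DensityResponse.Negative

end
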